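import Literature.Geometry.Hyperkaehler.Hyperholomorphic
import Mathlib.Analysis.SpecialFunctions.Pow.Real
import Mathlib.Tactic.Module
import HarnessLib

/-!
# The algebraic characterization of (generalized) twistor lines of complex tori: two complex structures with scalar
# anticommutator `J₁J₂ + J₂J₁ = 2α·Id` lie on a common compact twistor line iff `|α| < 1`, and generate `ℍ(1)`
# (`|α| > 1`) or `ℍ(0)` (`|α| = 1`) otherwise — the "orthogonalization process" (Buskin 2018, §1.1)

Topic `Literature/Geometry/Hyperkaehler`, namespace `Literature.Geometry.Hyperkaehler.TwistorLine`. Written by the literature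
seat `lit-w-verbitsky` (gen 13) of the cell `pub-hsemireg` (HodgeConjecture venture), 2026-08-25, as a companion to
`TwistorLineHodgeClassesDimension.lean` (row V-V13 of that cell's Verbitsky table: which pairs `(I, J)`, `(I, R)`, `(I, N)`
occur). THEOREMS ONLY (no definition, no named fact, no `sorry`); pure operator algebra on a real vector space. Nothing in
this file is a statement about the Hodge conjecture.

## Source, verbatim

N. Buskin, *A generalization of twistor lines for complex tori*, arXiv:1806.08390 (2018; PREPRINT), §1 and §1.1
"Algebraic characterization of twistor lines in `Compl`"; "chunk pNNNN Lm" = the corpus TeX text `paper:arxiv-1806.08390`: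

* chunk p0003 L63–69: "Introduce the following 4-dimensional real algebras,
  `ℍ(ε) = ⟨i, j | i² = −1, j² = ε, ij + ji = 0⟩`, `ε = −1, 0, 1`. The above introduced twistor spheres arise from embeddings
  of the algebra of quaternions `ℍ = ℍ(−1) ↪ End V_ℝ`. The non-compact analogs arise from the embeddings `ℍ(ε) ↪ End V_ℝ`
  for `ε = 0, 1`."
* chunk p0003 L78–91: "Let `I, J, K = IJ ∈ End V_ℝ` be complex structures satisfying the quaternionic identities and
  `S = S(I,J) = {aI + bJ + cK | a² + b² + c² = 1}` be the corresponding twistor sphere. The basis `I, J, K` of the space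
  `ℝ³ = ⟨I, J, K⟩ ⊂ End V_ℝ` is orthonormal with respect to the bilinear form `(u, v) = −(1/4n)·Tr(uv)`, which is positively
  definite on `⟨I, J, K⟩`. Moreover, `u, v ∈ ⟨I, J, K⟩` anticommute if and only if `u ⊥ v`. […] Let `J₁ ≠ ±J₂` be some
  complex structures in `S`. Then the plane `⟨J₁, J₂⟩_ℝ ⊂ End V_ℝ` intersects `S` in the circle `S ∩ ⟨J₁, J₂⟩_ℝ`, which
  contains a complex structure that anticommutes with `J₁` (this can be seen by the means of the orthogonalization process
  applied to the pair `J₁, J₂`)."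
* chunk p0003 L92–114, p0004 L1–7: "Thus there exists a real number `α` such that `αJ₁ + J₂` determines, after a scalar
  normalization, a complex structure in `S` anticommuting with `J₁`, that is (even without the normalization),
  `(αJ₁ + J₂)J₁ + J₁(αJ₁ + J₂) = 0`, which results in the relation `J₁J₂ + J₂J₁ = 2α·Id`. The fact that `αJ₁ + J₂` is
  proportional to a complex structure brings the following restriction on `α`, `(αJ₁ + J₂)² = a·Id`, `a < 0`, so that
  `J = (αJ₁ + J₂)/√(−a)` is a complex structure and `J` anticommutes with `I = J₁`. The left side `(αJ₁ + J₂)²` […] is equal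
  to `−(1 + α²)Id + α·(J₁J₂ + J₂J₁) = (α² − 1)Id`, and thus the condition `a = α² − 1 < 0` is simply the condition `|α| < 1`.
  Thus the necessary and sufficient condition that nonproportional `J₁, J₂` belong to the same twistor sphere `S = S(I,J)`
  is that there exists `α ∈ ℝ` such that `J₁J₂ + J₂J₁ = 2α·Id`, `|α| < 1`."
* chunk p0004 L9–15: "If we drop the restriction `|α| < 1` then the complex structure operators `J₁, J₂` satisfying
  `J₁² = J₂² = −Id`, `J₁J₂ + J₂J₁ = 2αId` generate the 4-dimensional algebra `ℍ(1) ⊂ End V_ℝ` if `|α| > 1` and the algebra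
  `ℍ(0) ⊂ End V_ℝ` if `|α| = 1`. Indeed, if `|α| > 1` then the above calculations show that `R = (αJ₁ + J₂)/√(α² − 1)`
  satisfies `R² = Id` and anticommutes with `I = J₁`, so that `I` and `R` generate a subalgebra of `End V_ℝ` isomorphic
  to `ℍ(1)`. If `|α| = 1` then `N = αJ₁ + J₂` is a nilpotent operator, `N² = 0`, and `N` anticommutes with `I = J₁` so
  that `I` and `N` generate a subalgebra isomorphic to `ℍ(0)`."; chunk p0004 L43–46, L62, L66–67: the lines
  `S(I,R) = {xI + yR + zIR | x² − y² − z² = 1}` and `S(I,N) = {±I + yN + zIN | y, z ∈ ℝ}`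
  ("`(xI + yN + zIN)² = −Id` if and only if `x = ±1`").

## What is formalised (`F` = `V_ℝ`, a real normed space — no finite-dimensionality is needed; `J₁, J₂ : F →L[ℝ] F` with
## `J₁² = J₂² = −1` and SCALAR anticommutator `J₁J₂ + J₂J₁ = 2α·1`, all hypotheses pointwise)

* `anticommutator_twistor`: on a twistor sphere the anticommutator is (minus twice) the dot product —
  `λμ + μλ = −2(aa′ + bb′ + cc′)·Id` for `λ = aL + bJ + cLJ`, `μ = a′L + b′J + c′LJ` ("`u, v` anticommute iff `u ⊥ v`"; the
  trace form `(u,v) = −Tr(uv)/4n` itself is not introduced), with the analogues `anticommutator_splitTwistor`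
  (`2(−xx′ + yy′ + zz′)` on `⟨I, R, IR⟩`) and `anticommutator_nilTwistor` (`−2xx′` on `⟨I, N, IN⟩`), whose diagonals are the
  printed squares `(xI + yR + zIR)² = (−x² + y² + z²)Id`, `(xI + yN + zIN)² = −x²Id`; hence `anticommutator_of_mem_sphere`: for `J₂ ∈ S(J₁, J)`,
  `J₂ = aJ₁ + bJ + cJ₁J`, the anticommutator is `J₁J₂ + J₂J₁ = −2a·Id`, and `abs_lt_one_of_mem_sphere`: `|a| < 1` as soon as
  `J₂ ≠ ±J₁` (the NECESSITY half of the characterization).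
* `orthogonalization_anticommute` ("`(αJ₁ + J₂)J₁ + J₁(αJ₁ + J₂) = 0`") and `orthogonalization_sq`
  ("`(αJ₁ + J₂)² = (α² − 1)Id`").
* `exists_anticommuting_of_abs_lt_one` (`|α| < 1`, the SUFFICIENCY half): `J = (αJ₁ + J₂)/√(1 − α²)` is a complex structure
  anticommuting with `J₁`, and `J₂ = −αJ₁ + √(1−α²)·J ∈ S(J₁, J)`.
* `exists_reflection_of_one_lt_abs` (`|α| > 1`): `R = (αJ₁ + J₂)/√(α² − 1)` satisfies `R² = Id`, `RJ₁ = −J₁R`, and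
  `J₂ = −αJ₁ + √(α²−1)·R ∈ S(J₁, R)` (`x² − y² − z² = 1`): "`I` and `R` generate a subalgebra isomorphic to `ℍ(1)`" is
  recorded as these relations (the abstract algebra `ℍ(1)` and the isomorphism are not introduced).
* `nilpotent_of_abs_eq_one` (`|α| = 1`): `N = αJ₁ + J₂` satisfies `N² = 0`, `NJ₁ = −J₁N`, `N ≠ 0` when `J₂ ≠ −αJ₁`, and
  `J₂ = −αJ₁ + N ∈ S(J₁, N)` (`x = −α = ∓1`).

## What is NOT here

The trace form `(u, v) = −Tr(uv)/4n` and the orthonormality of `I, J, K` for it; the reversed Cauchy–Schwarz inequality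
that would give `|α| > 1` for two distinct non-antipodal points of one sheet of `S(I, R)` (not printed); the algebras `ℍ(ε)` as abstract algebras, faithfulness, and everything about `Compl ⊂ Gr(2n, V_ℂ)` (Thm. 1.1); Thm. 1.2 is
the companion file `TwistorLineHodgeClassesDimension.lean`; Thm. 1.3, Rem. 1.4.

## References

* [Buskin2018GeneralizedTwistorLines] N. Buskin, *A generalization of twistor lines for complex tori*, arXiv:1806.08390
  (2018), §1, §1.1 — read in the corpus TeX text, chunks p0003–p0004.
-/

noncomputable section

open Module

namespace Literature.Geometry.Hyperkaehler.TwistorLine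

variable {F : Type*} [NormedAddCommGroup F] [NormedSpace ℝ F]

/-! ### §1 The anticommutator on a twistor sphere (necessity) -/

/-- **"`u, v ∈ ⟨I, J, K⟩` anticommute if and only if `u ⊥ v`"**, in the form: for `λ = aL + bJ + cLJ`, `μ = a′L + b′J + c′LJ`
on a twistor sphere (`L² = J² = −1`, `JL = −LJ`), `λμ + μλ = −2(aa′ + bb′ + cc′)·Id`.
[cite: Buskin2018GeneralizedTwistorLines, §1.1 (chunk p0003 L82–86)] -/
theorem anticommutator_twistor {L J : F →L[ℝ] F} (hL : ∀ v, L (L v) = -v) (hJ : ∀ v, J (J v) = -v)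
    (hLJ : ∀ v, J (L v) = -L (J v)) (a b c a' b' c' : ℝ) (v : F) :
    (a • L + b • J + c • L.comp J) ((a' • L + b' • J + c' • L.comp J) v) +
        (a' • L + b' • J + c' • L.comp J) ((a • L + b • J + c • L.comp J) v) =
      (-2 * (a * a' + b * b' + c * c')) • v := by
  simp only [_root_.add_apply, _root_.smul_apply, ContinuousLinearMap.coe_comp, Function.comp_apply, map_add, map_smul,
    hL, hJ, hLJ, map_neg, smul_neg, neg_neg]
  module

/-- The same on a line of type `ℍ(1)` (`I² = −1`, `R² = 1`, `RI = −IR`): for `λ = xI + yR + zIR`, `μ = x′I + y′R + z′IR`,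
`λμ + μλ = 2(−xx′ + yy′ + zz′)·Id` — the diagonal `λ = μ` is the printed "`(xI + yR + zIR)² = (−x² + y² + z²)Id`", and the
polar form is the "orthogonalization process … in all three cases `ε = −1, 0, 1`" for the indefinite form.
[cite: Buskin2018GeneralizedTwistorLines, §1.1 (chunk p0004 L17–22, L43–44)] -/
theorem anticommutator_splitTwistor {I R : F →L[ℝ] F} (hI : ∀ v, I (I v) = -v) (hR : ∀ v, R (R v) = v)
    (hIR : ∀ v, R (I v) = -I (R v)) (x y z x' y' z' : ℝ) (v : F) :
    (x • I + y • R + z • I.comp R) ((x' • I + y' • R + z' • I.comp R) v) +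
        (x' • I + y' • R + z' • I.comp R) ((x • I + y • R + z • I.comp R) v) =
      (2 * (-(x * x') + y * y' + z * z')) • v := by
  simp only [_root_.add_apply, _root_.smul_apply, ContinuousLinearMap.coe_comp, Function.comp_apply, map_add, map_smul,
    hI, hR, hIR, map_neg, smul_neg, neg_neg]
  module

/-- And on a line of type `ℍ(0)` (`I² = −1`, `N² = 0`, `NI = −IN`): for `λ = xI + aN + bIN`, `μ = x′I + a′N + b′IN`,
`λμ + μλ = −2xx′·Id` — on `S(I, N)` (`x, x′ = ±1`) the anticommutator is `±2·Id`, `|α| = 1`; the diagonal is the printed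
"`(xI + yN + zIN)² = −Id` if and only if `x = ±1`". [cite: Buskin2018GeneralizedTwistorLines, §1.1 (chunk p0004 L17–22,
L66–67)] -/
theorem anticommutator_nilTwistor {I N : F →L[ℝ] F} (hI : ∀ v, I (I v) = -v) (hN : ∀ v, N (N v) = 0)
    (hIN : ∀ v, N (I v) = -I (N v)) (x a b x' a' b' : ℝ) (v : F) :
    (x • I + a • N + b • I.comp N) ((x' • I + a' • N + b' • I.comp N) v) +
        (x' • I + a' • N + b' • I.comp N) ((x • I + a • N + b • I.comp N) v) =
      (-2 * (x * x')) • v := by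
  simp only [_root_.add_apply, _root_.smul_apply, ContinuousLinearMap.coe_comp, Function.comp_apply, map_add, map_smul,
    hI, hN, hIN, map_neg, map_zero, smul_neg, neg_neg, smul_zero, neg_zero, add_zero]
  module

/-- **Necessity: two points of a twistor sphere have scalar anticommutator `J₁J₂ + J₂J₁ = 2α·Id` with `α = −a`** for
`J₂ = aJ₁ + bJ + cJ₁J ∈ S(J₁, J)`. [cite: Buskin2018GeneralizedTwistorLines, §1.1 (chunk p0003 L88–102)] -/
theorem anticommutator_of_mem_sphere {J₁ J : F →L[ℝ] F} (h₁ : ∀ v, J₁ (J₁ v) = -v) (hJ : ∀ v, J (J v) = -v)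
    (hJ₁J : ∀ v, J (J₁ v) = -J₁ (J v)) {a b c : ℝ} {J₂ : F →L[ℝ] F} (hJ₂ : J₂ = a • J₁ + b • J + c • J₁.comp J) (v : F) :
    J₁ (J₂ v) + J₂ (J₁ v) = (2 * (-a)) • v := by
  have h := anticommutator_twistor h₁ hJ hJ₁J 1 0 0 a b c v
  simp only [one_smul, zero_smul, add_zero, one_mul, zero_mul] at h
  rw [hJ₂, h]
  ring_nf

/-- For `J₂ = aJ₁ + bJ + cJ₁J` on the sphere (`a² + b² + c² = 1`) with `J₂ ≠ ±J₁` ("nonproportional"), `|a| < 1` — so the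
`α = −a` of `anticommutator_of_mem_sphere` satisfies `|α| < 1` (for `|a| = 1` forces `b = c = 0`).
[cite: Buskin2018GeneralizedTwistorLines, §1.1 (chunk p0004 L1–7)] -/
theorem abs_lt_one_of_mem_sphere {J₁ J : F →L[ℝ] F} {a b c : ℝ} (habc : a ^ 2 + b ^ 2 + c ^ 2 = 1)
    {J₂ : F →L[ℝ] F} (hJ₂ : J₂ = a • J₁ + b • J + c • J₁.comp J) (hne : J₂ ≠ J₁) (hne' : J₂ ≠ -J₁) : |a| < 1 := by
  have ha : a ^ 2 ≤ 1 := by nlinarith [sq_nonneg b, sq_nonneg c]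
  have ha1 : |a| ≤ 1 := by
    rw [← abs_one]
    exact sq_le_sq.mp (by simpa using ha)
  rcases ha1.lt_or_eq with h | h
  · exact h
  exfalso
  have hbc : b = 0 ∧ c = 0 := by
    have : a ^ 2 = 1 := by rw [← sq_abs, h, one_pow]
    constructor <;> nlinarith [sq_nonneg b, sq_nonneg c]
  obtain ⟨rfl, rfl⟩ := hbc
  simp only [zero_smul, add_zero] at hJ₂
  rcases (abs_eq (zero_le_one)).mp h with rfl | rfl
  · exact hne (by rw [hJ₂, one_smul])
  · exact hne' (by rw [hJ₂, neg_one_smul])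

/-! ### §2 The orthogonalization `αJ₁ + J₂` -/

/-- **"`(αJ₁ + J₂)J₁ + J₁(αJ₁ + J₂) = 0`"**: if `J₁² = −1` and `J₁J₂ + J₂J₁ = 2α·Id`, then `αJ₁ + J₂` anticommutes with `J₁`.
[cite: Buskin2018GeneralizedTwistorLines, §1.1 (chunk p0003 L92–102)] -/
theorem orthogonalization_anticommute {J₁ J₂ : F →L[ℝ] F} (h₁ : ∀ v, J₁ (J₁ v) = -v) {α : ℝ}
    (hα : ∀ v, J₁ (J₂ v) + J₂ (J₁ v) = (2 * α) • v) (v : F) :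
    (α • J₁ + J₂) (J₁ v) = -J₁ ((α • J₁ + J₂) v) := by
  have h := hα v
  simp only [_root_.add_apply, _root_.smul_apply, map_add, map_smul, h₁, smul_neg]
  rw [eq_sub_of_add_eq' h] at *
  module

/-- **"`(αJ₁ + J₂)² = −(1 + α²)Id + α·(J₁J₂ + J₂J₁) = (α² − 1)Id`"**.
[cite: Buskin2018GeneralizedTwistorLines, §1.1 (chunk p0003 L104–114, p0004 L1)] -/
theorem orthogonalization_sq {J₁ J₂ : F →L[ℝ] F} (h₁ : ∀ v, J₁ (J₁ v) = -v) (h₂ : ∀ v, J₂ (J₂ v) = -v) {α : ℝ}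
    (hα : ∀ v, J₁ (J₂ v) + J₂ (J₁ v) = (2 * α) • v) (v : F) :
    (α • J₁ + J₂) ((α • J₁ + J₂) v) = (α ^ 2 - 1) • v := by
  have h := hα v
  simp only [_root_.add_apply, _root_.smul_apply, map_add, map_smul, h₁, h₂, smul_neg]
  rw [eq_sub_of_add_eq h]
  module

/-! ### §3 The trichotomy `|α| < 1`, `|α| > 1`, `|α| = 1` -/

/-- **Sufficiency (`|α| < 1`): "`J = (αJ₁ + J₂)/√(−a)` is a complex structure and `J` anticommutes with `I = J₁`", and the
nonproportional `J₁, J₂` "belong to the same twistor sphere `S = S(I, J)`"**: `J₂ = −αJ₁ + √(1−α²)·J + 0·J₁J` with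
`(−α)² + (√(1−α²))² + 0² = 1`. [cite: Buskin2018GeneralizedTwistorLines, §1.1 (chunk p0003 L104–112, p0004 L1–7)] -/
theorem exists_anticommuting_of_abs_lt_one {J₁ J₂ : F →L[ℝ] F} (h₁ : ∀ v, J₁ (J₁ v) = -v) (h₂ : ∀ v, J₂ (J₂ v) = -v)
    {α : ℝ} (hα : ∀ v, J₁ (J₂ v) + J₂ (J₁ v) = (2 * α) • v) (hlt : |α| < 1) :
    ∃ J : F →L[ℝ] F, (∀ v, J (J v) = -v) ∧ (∀ v, J (J₁ v) = -J₁ (J v)) ∧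
      ∃ a b c : ℝ, a ^ 2 + b ^ 2 + c ^ 2 = 1 ∧ J₂ = a • J₁ + b • J + c • J₁.comp J := by
  have hpos : 0 < 1 - α ^ 2 := by
    have : α ^ 2 < 1 := by
      have h := abs_lt.mp hlt
      nlinarith
    linarith
  set s := Real.sqrt (1 - α ^ 2) with hs
  have hs0 : 0 < s := Real.sqrt_pos.mpr hpos
  have hss : s * s = 1 - α ^ 2 := Real.mul_self_sqrt hpos.le
  refine ⟨s⁻¹ • (α • J₁ + J₂), fun v ↦ ?_, fun v ↦ ?_, -α, s, 0, ?_, ?_⟩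
  · rw [_root_.smul_apply, _root_.smul_apply, map_smul, orthogonalization_sq h₁ h₂ hα, smul_smul, smul_smul]
    have hs1 : s ≠ 0 := hs0.ne'
    have : s⁻¹ * s⁻¹ * (α ^ 2 - 1) = -1 := by
      field_simp
      nlinarith [hss]
    rw [this, neg_one_smul]
  · rw [_root_.smul_apply, _root_.smul_apply, orthogonalization_anticommute h₁ hα, map_smul, smul_neg]
  · nlinarith
  · rw [zero_smul, add_zero, smul_inv_smul₀ hs0.ne']
    module

/-- **`|α| > 1`: "`R = (αJ₁ + J₂)/√(α² − 1)` satisfies `R² = Id` and anticommutes with `I = J₁`, so that `I` and `R` generate a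
subalgebra of `End V_ℝ` isomorphic to `ℍ(1)`"**, and `J₂ = −αJ₁ + √(α²−1)·R + 0·J₁R` lies on the two-sheeted hyperboloid
`S(J₁, R)` (`x² − y² − z² = 1`). [cite: Buskin2018GeneralizedTwistorLines, §1.1 (chunk p0004 L9–13, L43–46)] -/
theorem exists_reflection_of_one_lt_abs {J₁ J₂ : F →L[ℝ] F} (h₁ : ∀ v, J₁ (J₁ v) = -v) (h₂ : ∀ v, J₂ (J₂ v) = -v)
    {α : ℝ} (hα : ∀ v, J₁ (J₂ v) + J₂ (J₁ v) = (2 * α) • v) (hgt : 1 < |α|) :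
    ∃ R : F →L[ℝ] F, (∀ v, R (R v) = v) ∧ (∀ v, R (J₁ v) = -J₁ (R v)) ∧
      ∃ x y z : ℝ, x ^ 2 - y ^ 2 - z ^ 2 = 1 ∧ J₂ = x • J₁ + y • R + z • J₁.comp R := by
  have hpos : 0 < α ^ 2 - 1 := by
    have : 1 < α ^ 2 := by
      have h := lt_abs.mp hgt
      rcases h with h | h <;> nlinarith
    linarith
  set s := Real.sqrt (α ^ 2 - 1) with hs
  have hs0 : 0 < s := Real.sqrt_pos.mpr hpos
  have hss : s * s = α ^ 2 - 1 := Real.mul_self_sqrt hpos.le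
  refine ⟨s⁻¹ • (α • J₁ + J₂), fun v ↦ ?_, fun v ↦ ?_, -α, s, 0, ?_, ?_⟩
  · rw [_root_.smul_apply, _root_.smul_apply, map_smul, orthogonalization_sq h₁ h₂ hα, smul_smul, smul_smul]
    have hs1 : s ≠ 0 := hs0.ne'
    have : s⁻¹ * s⁻¹ * (α ^ 2 - 1) = 1 := by
      field_simp
      nlinarith [hss]
    rw [this, one_smul]
  · rw [_root_.smul_apply, _root_.smul_apply, orthogonalization_anticommute h₁ hα, map_smul, smul_neg]
  · nlinarith
  · rw [zero_smul, add_zero, smul_inv_smul₀ hs0.ne']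
    module

/-- **`|α| = 1`: "`N = αJ₁ + J₂` is a nilpotent operator, `N² = 0`, and `N` anticommutes with `I = J₁` so that `I` and `N`
generate a subalgebra isomorphic to `ℍ(0)`"**; `N ≠ 0` for `J₂ ≠ −αJ₁` (nonproportional), and `J₂ = −αJ₁ + 1·N + 0·J₁N`
lies on `S(J₁, N) = {±J₁ + yN + zJ₁N}` (`(−α)² = 1`). [cite: Buskin2018GeneralizedTwistorLines, §1.1 (chunk p0004 L14–15,
L62, L66–67)] -/
theorem nilpotent_of_abs_eq_one {J₁ J₂ : F →L[ℝ] F} (h₁ : ∀ v, J₁ (J₁ v) = -v) (h₂ : ∀ v, J₂ (J₂ v) = -v) {α : ℝ}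
    (hα : ∀ v, J₁ (J₂ v) + J₂ (J₁ v) = (2 * α) • v) (habs : |α| = 1) :
    (∀ v, (α • J₁ + J₂) ((α • J₁ + J₂) v) = 0) ∧ (∀ v, (α • J₁ + J₂) (J₁ v) = -J₁ ((α • J₁ + J₂) v)) ∧
      (J₂ ≠ -(α • J₁) → α • J₁ + J₂ ≠ 0) ∧
      ∃ x y z : ℝ, x ^ 2 = 1 ∧ J₂ = x • J₁ + y • (α • J₁ + J₂) + z • J₁.comp (α • J₁ + J₂) := by
  have hα2 : α ^ 2 = 1 := by rw [← sq_abs, habs, one_pow]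
  refine ⟨fun v ↦ ?_, orthogonalization_anticommute h₁ hα, fun hne hN ↦ hne ?_, -α, 1, 0, by rw [neg_sq, hα2], ?_⟩
  · rw [orthogonalization_sq h₁ h₂ hα, hα2, sub_self, zero_smul]
  · rwa [add_eq_zero_iff_eq_neg'] at hN
  · ext v
    simp only [_root_.add_apply, _root_.smul_apply, one_smul, zero_smul, add_zero]
    module

end Literature.Geometry.Hyperkaehler.TwistorLine
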